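import Summits.HubbardSuperconductivity.HubbardSuperconductivity.Theorems.AnisotropyChordChordXYTangentBound

/-!
# Route `AnisotropyChord`, crux `ChordXY` (stmt-HubbardSuperconductivity-8146), line `doob-johnson-chord`:
# the skeleton's statement abbreviations, and the registered stub `stub_tangentBound` BY NAME

The registered crux-plan skeleton `Cruxes/ChordXY/Lines/doob_johnson_chord.lean` (sha `726814ba1f70…`,
`ChordXY_of : Theses.AnisotropyChord.ChordXY` kernel-checked modulo exactly `stub_tangentBound` and
`stub_frozenFieldChord`) states its two stubs in a LOCAL VOCABULARY. Those abbreviations are landed here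
VERBATIM (namespace `…Theorems.AnisotropyChord.DoobJohnsonChord`), so that stubs and plan-layer lemmas of
the line can be closed BY NAME in `Theorems/` and the lead skeleton imports them instead of re-declaring:

* `Config M` — `S^z`-basis configurations `TensorIndex (TorusSite 2 M) 2` of the spin-½ `M × M` torus;
* `Hxxz M Δ` — `H_M(Δ) = xxzHamiltonian 1 (torusGraph 2 M) (-1) Δ`;
* `Otot M` — the condensate operator `O = S⁺_tot S⁻_tot` (the same term as `condensateOp M` of
  `…ThermalCondensateDefs`, kept under the skeleton's name so that registered signatures match textually);
* `lam M φ` — `Λ(φ) = Re⟨φ, O φ⟩`;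
* `IsGS M Δ φ` — `φ` is a normalised `S^z_tot = 0` sector ground state of `H_M(Δ)` (the three binders of
  the route item `ChordXY`, verbatim);
* `ofReal M ψ` — a real amplitude as a complex vector;
* `field M ψ σ` — the Doob–Johnson LOCAL FIELD (mixed estimator) `g_ψ(σ) = Re(Oψ)(σ)/ψ(σ)` of `O` in the
  real amplitude `ψ` (Lean's `x / 0 = 0` off the support; only values on `supp ψ` are ever used);

each with an unfolding lemma (`rfl`), and the registered stub

* `stub_tangentBound` — `∀ M ψ φ, ψ ≥ 0 → (φ σ ≠ 0 → ψ σ > 0) → Λ(φ) ≤ Σ_σ ‖φ σ‖² g_ψ(σ)`, which with the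
  abbreviations unfolded is the landed `chordXY_tangentBound` (`…ChordXYTangentBound`: AM–GM per entry of
  the symmetric `ℝ≥0`-matrix `O`, summed).

The other registered stub `stub_frozenFieldChord` (the frozen-field chord `(1+Δ)·E_{|ψ₀|²}[g_Δ] ≤ Λ(ψ_Δ)`,
XL, the open research step of the line) is NOT touched here. Sources: J. L. Doob (1957) h-transform;
VMC mixed/local estimators (Gubernatis–Kawashima–Werner, *Quantum Monte Carlo Methods* (2016) §10);
H. Tasaki, *Physics and Mathematics of Quantum Many-Body Systems* (2020) §2.2, §2.4. The definitions are
statement abbreviations (no mathematical content). HONEST: nothing here proves `ChordXY`;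
superconductivity in the Hubbard model is not advanced.
-/

set_option linter.dupNamespace false

noncomputable section

namespace Summit.HubbardSuperconductivity.HubbardSuperconductivity.Theorems.AnisotropyChord.DoobJohnsonChord

open Matrix Complex Finset
open Literature.MathematicalPhysics.QuantumLattice Literature.Probability.LatticeModels

/-- `S^z`-basis configurations of the `M × M` spin-½ torus — verbatim the skeleton's `Config`.
Tasaki (2020) §2.2. [statement abbreviation] -/
abbrev Config (M : ℕ) : Type := TensorIndex (TorusSite 2 M) 2

/-- `H_M(Δ) = xxzHamiltonian 1 (torusGraph 2 M) (-1) Δ` — verbatim the skeleton's `Hxxz`.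
Tasaki (2020) §2.4. [statement abbreviation] -/
abbrev Hxxz (M : ℕ) [NeZero M] (Δ : ℝ) : Matrix (Config M) (Config M) ℂ :=
  xxzHamiltonian 1 (torusGraph 2 M) (-1) Δ

/-- `O = S⁺_tot S⁻_tot` — verbatim the skeleton's `Otot` (the same term as `condensateOp M`).
Kennedy–Lieb–Shastry (1988). [statement abbreviation] -/
abbrev Otot (M : ℕ) [NeZero M] : Matrix (Config M) (Config M) ℂ :=
  (∑ x : TorusSite 2 M, onSite x (spinRaise 1)) * (∑ y : TorusSite 2 M, onSite y (spinLower 1))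

/-- `Λ(φ) = Re⟨φ, O φ⟩`, the condensate of an amplitude `φ` — verbatim the skeleton's `lam`.
Kennedy–Lieb–Shastry (1988). [statement abbreviation] -/
def lam (M : ℕ) [NeZero M] (φ : Config M → ℂ) : ℝ := (star φ ⬝ᵥ (Otot M *ᵥ φ)).re

/-- `φ` is a normalised `S^z_tot = 0` sector ground state of `H_M(Δ)` (the crux's three hypotheses) —
verbatim the skeleton's `IsGS`. [statement abbreviation] -/
abbrev IsGS (M : ℕ) [NeZero M] (Δ : ℝ) (φ : Config M → ℂ) : Prop :=
  φ ∈ spinZSector (Λ := TorusSite 2 M) 1 0 ∧ star φ ⬝ᵥ φ = 1 ∧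
    Hxxz M Δ *ᵥ φ = ((lowestEnergyInSector 1 (Hxxz M Δ) 0 : ℝ) : ℂ) • φ

/-- A real amplitude viewed as a complex vector — verbatim the skeleton's `ofReal`.
[statement abbreviation] -/
def ofReal (M : ℕ) (ψ : Config M → ℝ) : Config M → ℂ := fun σ => (ψ σ : ℂ)

/-- The Doob–Johnson LOCAL FIELD (mixed estimator) of `O` in the real amplitude `ψ`:
`g_ψ(σ) = Re(Oψ)(σ) / ψ(σ)` (Lean's `x / 0 = 0` off the support; only values on `supp ψ` are ever used)
— verbatim the skeleton's `field`. Doob (1957); Gubernatis–Kawashima–Werner (2016) §10.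
[statement abbreviation] -/
def field (M : ℕ) [NeZero M] (ψ : Config M → ℝ) (σ : Config M) : ℝ :=
  ((Otot M *ᵥ ofReal M ψ) σ).re / ψ σ

/-- Unfolding lemma for `lam`. [bookkeeping] -/
theorem lam_eq (M : ℕ) [NeZero M] (φ : Config M → ℂ) :
    lam M φ = (star φ ⬝ᵥ (Otot M *ᵥ φ)).re := rfl

/-- Unfolding lemma for `ofReal`. [bookkeeping] -/
theorem ofReal_apply (M : ℕ) (ψ : Config M → ℝ) (σ : Config M) : ofReal M ψ σ = (ψ σ : ℂ) := rfl

/-- Unfolding lemma for `field`. [bookkeeping] -/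
theorem field_eq (M : ℕ) [NeZero M] (ψ : Config M → ℝ) (σ : Config M) :
    field M ψ σ = ((Otot M *ᵥ ofReal M ψ) σ).re / ψ σ := rfl

/-- **Registered stub `stub_tangentBound`** (skeleton `Cruxes/ChordXY/Lines/doob_johnson_chord.lean`, sha
`726814ba1f70…`), BY NAME — the AM–GM TANGENT BOUND of the concave functional `p ↦ Λ(√p)` at `q = ψ²`:
for `ψ ≥ 0` and `φ` supported inside `supp ψ`, `Λ(φ) ≤ Σ_σ ‖φ σ‖² g_ψ(σ)`. With the abbreviations
unfolded this is `chordXY_tangentBound` (per entry `2|φ σ||φ τ| ≤ |φ σ|² ψ τ/ψ σ + |φ τ|² ψ σ/ψ τ`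
against the symmetric `ℝ≥0`-matrix `O`, summed). Doob (1957) h-transform / Johnson's mixed estimator.
[folklore] -/
theorem stub_tangentBound : ∀ (M : ℕ) [NeZero M] (ψ : Config M → ℝ) (φ : Config M → ℂ), (∀ σ, 0 ≤ ψ σ) → (∀ σ, φ σ ≠ 0 → 0 < ψ σ) → lam M φ ≤ ∑ σ, ‖φ σ‖ ^ 2 * field M ψ σ :=
  chordXY_tangentBound

end Summit.HubbardSuperconductivity.HubbardSuperconductivity.Theorems.AnisotropyChord.DoobJohnsonChord

end
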